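import Literature.Geometry.Kaehler.RiemannSurfaceChevalleyWeilBranchValues
import Literature.Geometry.Kaehler.RiemannSurfaceQDifferentialRepresentationFaithful
import HarnessLib

/-!
# The Chevalley–Weil formula for holomorphic `q`-differentials, `q ≥ 2`: the multiplicity of `V` in `𝓗^q(M)` is
# `(2q − 1)·d_V·(γ − 1) + Σ_t [(q − 1)·d_V·(1 − 1/m_t) + Σ_α N_{t,α}·{(α + q − 1)/m_t}]`
# (Kopeliovich–Zemel Theorem 6.6 at `Γ = 0`; Chevalley–Weil 1934)

Layer `Literature/Geometry/Kaehler`, sequel of `RiemannSurfaceChevalleyWeilFormula` / `…BranchValues` (the case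
`q = 1`, `𝓗¹(M)`), of `RiemannSurfaceEichlerTraceFormulaQDifferentials` (Farkas–Kra V.2.9 for `q ≥ 2`:
`tr T = Σ_{P ∈ Fix T} a_P(T⁻¹)^q/(1 − a_P(T⁻¹))` on `𝓗^q(M) = L(q·(π^*ω̃))`, `π : M → M/⟨T⟩`) and of
`RiemannSurfaceQDifferentialRepresentationFaithful` (independence of the model `L(qK₀)` of the invariant form
`ω₀` and of the group: `trace_LCRep_eq_of_pullback_eq`, `LCRep_eq_of_forall_smul_eq`). S. Kopeliovich, S. Zemel,
Israel J. Math. 234 (2019), as printed (arXiv copy pp. 28–29):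

> **Theorem 6.6.** Let `f : X → S` be a Galois cover, with Galois group `G`, and take an index `q` and an integral
> divisor `Γ` on `S`. […] Then a representation `ρ ∈ Irr_ℂ(G)` appears in the representation of `G` on the space
> `Ω^q(1/f^*(Γ))` with multiplicity
> `d_ρ[(2q − 1)(g_S − 1) + deg Γ] + Σ_C r_C Σ_{α=0}^{o(C)−1} N^ρ_{C,α}[(q − 1)(1 − 1/o(C)) + {(q − 1 − α)/o(C)}]`,
> plus `1` if the parameter `δ` from Proposition 6.5 equals `1` and `ρ` is the 1-dimensional representation
> denoted by `χ_δ` there.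
> *Proof.* […] the multiplicity of `ρ` inside any representation of `G` on some vector space `V` is
> `(1/n) Σ_{τ ∈ G} χ_V(τ)χ_ρ(τ⁻¹)`. […] The expression for `τ = Id_X` is just the dimension of the space
> `Ω^q(1/f^*(Γ))` […] `(2q − 1)(g_X − 1) + n deg Γ + δ` […] Applying the Riemann–Hurwitz formula […] For `τ ≠ Id_X`,
> […] we consider, for each point `P ∈ X`, its stabilizer in `G`. […]

For `q ≥ 2` on `M` of genus `g ≥ 2` the parameter `δ` vanishes (`Γ = 0`), Eichler's formula has no constant term,
and the theorem reads, in the tree's normalisation (`a_P = stabDeriv P` the rotation character of `G_P`,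
`m_P = |G_P|`, `N_{P,α}` the multiplicity of `a_P^α` in `V|_{G_P}`; `𝓗^q(M) = L(qK₀)` for `K₀ = (ω₀)`, `ω₀` ANY
`G`-invariant meromorphic form not vanishing identically near a point — e.g. `π^*ω̃` — with `G` acting by
`LCRep`, `Tφ = φ ∘ T⁻¹`):

  `Σ_{h ∈ G} tr(h⁻¹|𝓗^q(M))·χ_V(h) = |G|·(2q − 1)·dim V·(γ − 1) + Σ_{P : G_P ≠ 1} ((q − 1)·dim V·(m_P − 1) + Σ_{α<m_P} ((α + q − 1) mod m_P)·N_{P,α})`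

for EVERY finite-dimensional representation `(V, ρ)` of `G ≤ Aut M`, and, grouped over the branch values `q_t`
(`|G|/m_t` points each, `a_{gP}(ghg⁻¹) = a_P(h)`),

  `|G|⁻¹ Σ_h tr(h⁻¹|𝓗^q)·χ_V(h) = (2q − 1)·dim V·(γ − 1) + Σ_t [(q − 1)·dim V·(1 − 1/m_t) + Σ_α N_{t,α}·((α + q − 1) mod m_t)/m_t]`,

which for irreducible `V` is the printed multiplicity (the source's `N^ρ_{C,α}` is indexed through `ζ_{o(C)}` and
the generator `ψ(P)`, i.e. our `N_{P,−α}`: `{(q − 1 − (−α))/m} = {(α + q − 1)/m}`). The local computation is the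
root-of-unity sum `Σ_{k=1}^{m−1} ε^{kβ}/(1 − ε^k) = ((β − 1) mod m) − (m − 1)/2` (§1) applied to `β = α + q`; the
terms `−dim V·(m_P − 1)/2` combine with `(2q − 1)(g − 1)·dim V` through Riemann–Hurwitz
`2g − 2 = |G|(2γ − 2) + Σ_P (m_P − 1)` into `(q − 1)·dim V·Σ_P (m_P − 1)`.

## What is formalized (everything proved; no definitions, no named facts, no instances)

* §1 `sum_Ico_pow_mul_div_one_sub_pow` (`Σ_{k=1}^{m−1} ε^{kβ}/(1 − ε^k) = ((β − 1) mod m) − (m − 1)/2`, `β ≥ 1`);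
* §2 `sum_Ico_stabDeriv_pow_mul_div_mul_trace_eq`, **`sum_stabilizer_stabDeriv_pow_div_mul_trace_eq`**
  (`Σ_{h ∈ G_P∖1} a_P(h)^q χ_V(h)/(1 − a_P(h)) = Σ_α ((α + q − 1) mod m)·N_{P,α} − dim V·(m − 1)/2`, `q ≥ 1`);
* §3 **`trace_LCRep_subgroup_eq_sum_fixedBy`** (Eichler for `h ∈ G`, `h ≠ 1`, in the `G`-model `L(qK₀)`),
  `trace_LCRep_subgroup_inv_eq_sum_fixedBy`, `trace_LCRep_subgroup_one` (`= (2q − 1)(g − 1)`),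
  **`chevalleyWeil_qDifferentials_sum_trace_inv_mul_trace_eq`** (chosen generators),
  **`chevalleyWeil_qDifferentials_sum_trace_inv_mul_trace_eq_iInf`** (intrinsic), `finrank_iInf_eigenspace_smul`
  (`N_{g•P,α} = N_{P,α}`), **`chevalleyWeil_qDifferentials_multiplicity_eq_sum_branchValues`** (the printed shape).

## References

* S. Kopeliovich, S. Zemel, *On spaces associated with invariant divisors on Galois covers of Riemann surfaces and
  their applications*, Israel J. Math. 234 (2019), Proposition 6.5, Theorem 6.6 with proof (arXiv:1609.02296,
  pp. 26–29). [KopeliovichZemel2019]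
* C. Chevalley, A. Weil, *Über das Verhalten der Integrale 1. Gattung bei Automorphismen des Funktionenkörpers*,
  Abh. Math. Sem. Hamburg 10 (1934), 358–361 (and Weil's sequel for differentials of higher order). [ChevalleyWeil1934Integrale]
* H. M. Farkas, I. Kra, *Riemann Surfaces*, GTM 71, 2nd ed. (1992), V.2.9 (Eichler trace formula, `q ≥ 1`), V.2.7,
  III.5.2 (`dim 𝓗^q = (2q − 1)(g − 1)`). [FarkasKra1992]
-/

noncomputable section

open scoped Manifold ContDiff Topology
open Set Filter Function Complex MulAction Module

namespace Literature.Geometry.Kaehler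

namespace RiemannSurface

open OrbitSurface FunctionField

/-! ### §1 The root-of-unity sum `Σ_{k=1}^{m−1} ε^{kβ}/(1 − ε^k) = ((β − 1) mod m) − (m − 1)/2` -/

section RootsOfUnity

variable {m : ℕ} {ε : ℂ}

/-- **`Σ_{k=1}^{m−1} ε^{kβ}/(1 − ε^k) = ((β − 1) mod m) − (m − 1)/2`** for a primitive `m`-th root of unity `ε` and
every `β ≥ 1` (the case `β ≤ m` is `sum_Ico_pow_mul_succ_div_one_sub_pow`; the sum only depends on `β mod m`).
[cite: KopeliovichZemel2019, Theorem 6.6 (proof: «the fractional part … `{(q − 1 − α)/o(C)}`»)]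
[cite: FarkasKra1992, V.2.7] -/
theorem sum_Ico_pow_mul_div_one_sub_pow (hε : IsPrimitiveRoot ε m) (hm : 0 < m) {β : ℕ} (hβ : 1 ≤ β) :
    ∑ k ∈ Finset.Ico 1 m, ε ^ (k * β) / (1 - ε ^ k) = (((β - 1) % m : ℕ) : ℂ) - ((m : ℂ) - 1) / 2 := by
  have hr : (β - 1) % m < m := Nat.mod_lt _ hm
  rw [← sum_Ico_pow_mul_succ_div_one_sub_pow hε hm hr]
  refine Finset.sum_congr rfl fun k _ ↦ ?_
  have hmod : ((β - 1) % m + 1) % m = β % m := by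
    conv_rhs => rw [show β = β - 1 + 1 by omega]
    rw [Nat.add_mod, Nat.mod_mod, ← Nat.add_mod]
  have hpow : ε ^ ((β - 1) % m + 1) = ε ^ β := by
    rw [← pow_mod_orderOf ε ((β - 1) % m + 1), ← pow_mod_orderOf ε β, ← hε.eq_orderOf, hmod]
  rw [mul_comm k β, pow_mul, mul_comm k, pow_mul, hpow]

end RootsOfUnity

/-! ### §2 The local contribution of a ramification point to `Σ_h tr(h⁻¹|𝓗^q)χ_V(h)` -/

section Local

variable {M : Type*} [TopologicalSpace M] [ChartedSpace ℂ M] [IsManifold 𝓘(ℂ, ℂ) ω M]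
  [CompactSpace M] [T2Space M] [PreconnectedSpace M] [Nonempty M] [Finite (autGroup M)]
  (G : Subgroup (autGroup M)) {V : Type*} [AddCommGroup V] [Module ℂ V] [FiniteDimensional ℂ V]
  (ρ : Representation ℂ ↥G V)

omit [CompactSpace M] [Nonempty M] in
/-- **The local computation for `q`-differentials**: for a generator `g` of `G_P` (`m = |G_P|`, `ε = a_P(g)`,
`N_α = dim Eig(ρ(g), ε^α)`) and `q ≥ 1`,
`Σ_{k=1}^{m−1} ε^{kq}·χ_V(g^k)/(1 − ε^k) = Σ_α ((α + q − 1) mod m)·N_α − dim V·(m − 1)/2`.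
[cite: KopeliovichZemel2019, Theorem 6.6 (proof), Proposition 6.5] -/
theorem sum_Ico_stabDeriv_pow_mul_div_mul_trace_eq {q : ℕ} (hq : 1 ≤ q) {P : M} {g : ↥G} (hg : g • P = P)
    (hgen : ∀ u : stabilizer G P, u ∈ Subgroup.zpowers (⟨g, mem_stabilizer_iff.2 hg⟩ : stabilizer G P)) :
    ∑ k ∈ Finset.Ico 1 (Nat.card (stabilizer G P)),
        (stabDeriv P g ^ k) ^ q / (1 - stabDeriv P g ^ k) * LinearMap.trace ℂ V (ρ (g ^ k)) =
      ∑ α ∈ Finset.range (Nat.card (stabilizer G P)),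
          (((α + q - 1) % Nat.card (stabilizer G P) : ℕ) : ℂ) *
            finrank ℂ ↥(Module.End.eigenspace (ρ g) (stabDeriv P g ^ α)) -
        (finrank ℂ V : ℂ) * (((Nat.card (stabilizer G P) : ℕ) : ℂ) - 1) / 2 := by
  set m := Nat.card (stabilizer G P) with hm
  set ε := stabDeriv P g with hε'
  have hm0 : 0 < m := Nat.card_pos
  have hε : IsPrimitiveRoot ε m := isPrimitiveRoot_stabDeriv_of_forall_mem_zpowers G hg hgen
  have hf : ρ g ^ m = 1 := map_pow_card_stabilizer_eq_one G ρ hg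
  have htr : ∀ k, LinearMap.trace ℂ V (ρ (g ^ k)) =
      ∑ α ∈ Finset.range m, ε ^ (k * α) * (finrank ℂ ↥(Module.End.eigenspace (ρ g) (ε ^ α)) : ℂ) := by
    intro k
    rw [map_pow]
    exact trace_pow_eq_sum_pow_mul_finrank_eigenspace hε hm0 hf k
  simp_rw [htr, Finset.mul_sum]
  rw [Finset.sum_comm]
  have hinner : ∀ α ∈ Finset.range m, ∑ k ∈ Finset.Ico 1 m,
      (ε ^ k) ^ q / (1 - ε ^ k) * (ε ^ (k * α) * (finrank ℂ ↥(Module.End.eigenspace (ρ g) (ε ^ α)) : ℂ)) =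
      ((((α + q - 1) % m : ℕ) : ℂ) - ((m : ℂ) - 1) / 2) * (finrank ℂ ↥(Module.End.eigenspace (ρ g) (ε ^ α)) : ℂ) := by
    intro α _
    rw [← sum_Ico_pow_mul_div_one_sub_pow hε hm0 (β := α + q) (by omega), Finset.sum_mul]
    refine Finset.sum_congr rfl fun k _ ↦ ?_
    rw [show k * (α + q) = k * q + k * α by ring, pow_add, pow_mul]
    ring
  rw [Finset.sum_congr rfl hinner]
  simp_rw [sub_mul, Finset.sum_sub_distrib, ← Finset.mul_sum]
  rw [sum_finrank_eigenspace_eq_finrank hε hm0 hf]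
  ring

omit [CompactSpace M] [Nonempty M] in
open Classical in
/-- **The contribution of a ramification point `P`, summed over `G_P ∖ {1}`** (`q ≥ 1`):
`Σ_{h ∈ G_P, h ≠ 1} a_P(h)^q·χ_V(h)/(1 − a_P(h)) = Σ_α ((α + q − 1) mod m)·N_{P,α} − dim V·(m − 1)/2`.
[cite: KopeliovichZemel2019, Theorem 6.6 (proof)] -/
theorem sum_stabilizer_stabDeriv_pow_div_mul_trace_eq [Fintype ↥G] [DecidableEq ↥G] {q : ℕ} (hq : 1 ≤ q) {P : M}
    {g : ↥G} (hg : g • P = P)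
    (hgen : ∀ u : stabilizer G P, u ∈ Subgroup.zpowers (⟨g, mem_stabilizer_iff.2 hg⟩ : stabilizer G P)) :
    ∑ h ∈ (Finset.univ.filter fun h : ↥G ↦ h • P = P).erase 1,
        stabDeriv P h ^ q / (1 - stabDeriv P h) * LinearMap.trace ℂ V (ρ h) =
      ∑ α ∈ Finset.range (Nat.card (stabilizer G P)),
          (((α + q - 1) % Nat.card (stabilizer G P) : ℕ) : ℂ) *
            finrank ℂ ↥(Module.End.eigenspace (ρ g) (stabDeriv P g ^ α)) -
        (finrank ℂ V : ℂ) * (((Nat.card (stabilizer G P) : ℕ) : ℂ) - 1) / 2 := by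
  have hord := orderOf_eq_card_stabilizer G hg hgen
  rw [filter_smul_eq_erase_one_eq_image_pow G hg hgen, Finset.sum_image fun i hi j hj h ↦ by
    rw [Finset.mem_coe, Finset.mem_Ico, ← hord] at hi hj
    exact pow_injOn_Iio_orderOf (Set.mem_Iio.2 hi.2) (Set.mem_Iio.2 hj.2) h]
  simp_rw [stabDeriv_pow G hg]
  exact sum_Ico_stabDeriv_pow_mul_div_mul_trace_eq G ρ hq hg hgen

end Local

/-! ### §3 The character of `G` on `𝓗^q(M) = L(qK₀)` (Eichler, `q ≥ 2`) and the Chevalley–Weil formula -/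

section Global

variable {M : Type*} [TopologicalSpace M] [ChartedSpace ℂ M] [IsManifold 𝓘(ℂ, ℂ) ω M]
  [CompactSpace M] [T2Space M] [PreconnectedSpace M] [Nonempty M] [Finite (autGroup M)]
  (G : Subgroup (autGroup M)) {V : Type*} [AddCommGroup V] [Module ℂ V] [FiniteDimensional ℂ V]
  (ρ : Representation ℂ ↥G V) {ω₀ : MeromorphicOneForm M} (hω₀ : ∀ p, ω₀.meromorphicOrderAt p ≠ ⊤)
  (hinv : ∀ h : ↥G, ω₀.pullback (hhol_of_holomorphicSMul h) = ω₀)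

include hω₀ hinv

/-- **Eichler's trace formula for `q ≥ 2` in the `G`-model `𝓗^q(M) = L(qK₀)`, `K₀ = (ω₀)` any `G`-invariant
meromorphic form**: for `h ∈ G`, `h ≠ 1` (`g ≥ 2`), `tr(h | L(qK₀)) = Σ_{P ∈ Fix h} a_P(h⁻¹)^q/(1 − a_P(h⁻¹))`
(the model and the group are changed along `trace_LCRep_eq_of_pullback_eq`, `LCRep_eq_of_forall_smul_eq`).
[cite: FarkasKra1992, V.2.9 Theorem] [cite: KopeliovichZemel2019, Proposition 6.5] -/
theorem trace_LCRep_subgroup_eq_sum_fixedBy (hg : 2 ≤ arithGenus M) {q : ℕ} (hq : 2 ≤ q) {h : ↥G} (hh : h ≠ 1) :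
    LinearMap.trace ℂ ↥(LC (q • ω₀.divisor)) (LCRep ↥G (q • ω₀.divisor) (nsmul_divisor_smul_eq hω₀ hinv q) h) =
      ∑ P ∈ (finite_fixedBy (M := M) hh).toFinset, stabDeriv P h⁻¹ ^ q / (1 - stabDeriv P h⁻¹) := by
  set σ : autGroup M := (h : autGroup M) with hσdef
  have hσ1 : σ ≠ 1 := fun h1 ↦ hh (OneMemClass.coe_eq_one.1 h1)
  have hσfin : IsOfFinOrder σ := isOfFinOrder_of_finite σ
  have hhσ : ∀ x : M, h • x = σ • x := fun x ↦ rfl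
  have hinvσ1 : ω₀.pullback (hhol_of_holomorphicSMul σ) = ω₀ :=
    (MeromorphicOneForm.pullback_congr (hhol_of_holomorphicSMul σ) (hhol_of_holomorphicSMul h)
      (funext fun x ↦ (hhσ x).symm) ω₀).trans (hinv h)
  have hinvσ : ∀ g : ↥(Subgroup.zpowers σ), ω₀.pullback (hhol_of_holomorphicSMul g) = ω₀ :=
    MeromorphicOneForm.pullback_zpowers_smul_eq hσfin hinvσ1
  have e1 : LCRep ↥G (q • ω₀.divisor) (nsmul_divisor_smul_eq hω₀ hinv q) h =
      LCRep (Subgroup.zpowers σ) (q • ω₀.divisor) (nsmul_divisor_smul_eq hω₀ hinvσ q) ⟨σ, Subgroup.mem_zpowers σ⟩ :=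
    LCRep_eq_of_forall_smul_eq fun x ↦ rfl
  obtain ⟨ω₁, hω₁⟩ := exists_meromorphicOrderAt_ne_top (M := OrbitSurface (Subgroup.zpowers σ) M)
  have e2 := trace_LCRep_eq_of_pullback_eq (H := ↥(Subgroup.zpowers σ)) hω₀
    (meromorphicOrderAt_pullback_mk_ne_top hω₁) hinvσ (pullback_smul_pullback_mk ω₁) q
    (nsmul_divisor_smul_eq hω₀ hinvσ q) (nsmul_divisor_pullback_mk_smul hω₁ q) ⟨σ, Subgroup.mem_zpowers σ⟩
  rw [e1, e2, trace_LCRep_eq_sum_fixedBy hg hq hσ1 hω₁]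
  exact Finset.sum_congr (by ext P; simp only [Set.Finite.mem_toFinset, mem_fixedBy]; rfl) fun P _ ↦ rfl

/-- Eichler at `h⁻¹` in the `G`-model: `tr(h⁻¹ | L(qK₀)) = Σ_{P ∈ Fix h} a_P(h)^q/(1 − a_P(h))`.
[cite: FarkasKra1992, V.2.9 Theorem] -/
theorem trace_LCRep_subgroup_inv_eq_sum_fixedBy (hg : 2 ≤ arithGenus M) {q : ℕ} (hq : 2 ≤ q) {h : ↥G}
    (hh : h ≠ 1) :
    LinearMap.trace ℂ ↥(LC (q • ω₀.divisor)) (LCRep ↥G (q • ω₀.divisor) (nsmul_divisor_smul_eq hω₀ hinv q) h⁻¹) =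
      ∑ P ∈ (finite_fixedBy (M := M) hh).toFinset, stabDeriv P h ^ q / (1 - stabDeriv P h) := by
  rw [trace_LCRep_subgroup_eq_sum_fixedBy G hω₀ hinv hg hq (inv_ne_one.2 hh)]
  simp_rw [inv_inv]
  refine Finset.sum_congr ?_ fun P _ ↦ rfl
  ext P
  simp only [Set.Finite.mem_toFinset, mem_fixedBy, inv_smul_eq_iff]
  exact eq_comm

omit [Finite ↥(autGroup M)] in
/-- **`tr(1 | L(qK₀)) = dim 𝓗^q(M) = (2q − 1)(g − 1)`** (`q ≥ 2`, `g ≥ 2`, Riemann–Roch). [cite: FarkasKra1992, III.5.2]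
[cite: KopeliovichZemel2019, Theorem 6.6 (proof: «the expression for `τ = Id_X` is just the dimension»)] -/
theorem trace_LCRep_subgroup_one (hg : 2 ≤ arithGenus M) {q : ℕ} (hq : 2 ≤ q) :
    LinearMap.trace ℂ ↥(LC (q • ω₀.divisor)) (LCRep ↥G (q • ω₀.divisor) (nsmul_divisor_smul_eq hω₀ hinv q) 1) =
      (2 * (q : ℂ) - 1) * ((arithGenus M : ℂ) - 1) := by
  haveI := moduleFinite_LC (M := M) (q • ω₀.divisor)
  rw [map_one, LinearMap.trace_one, finrank_LC]
  have h1 := finrank_riemannRochSubmodule_smul_divisor hω₀ hg hq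
  have h2 := congrArg (fun z : ℤ ↦ (z : ℂ)) h1
  push_cast at h2
  rw [h2]
  ring

open Classical in
/-- **THE CHEVALLEY–WEIL FORMULA FOR HOLOMORPHIC `q`-DIFFERENTIALS, `q ≥ 2`** (with chosen generators `g_P` of the
stabilizers; `g ≥ 2`, `G ≤ Aut M`, `γ` the genus of `M/G`, `m_P = |G_P|`, `N_{P,α} = dim Eig(ρ(g_P), a_P(g_P)^α)`):
for every finite-dimensional complex representation `(V, ρ)` of `G`,
`Σ_{h ∈ G} tr(h⁻¹|𝓗^q(M))·χ_V(h) = |G|·(2q − 1)·dim V·(γ − 1) + Σ_{P : G_P ≠ 1} ((q − 1)·dim V·(m_P − 1) + Σ_α ((α + q − 1) mod m_P)·N_{P,α})`.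
Dividing by `|G|` and grouping the `|G|/m_t` points over each branch value: the multiplicity of an irreducible `V` in
`𝓗^q(M)` is `d_V(2q − 1)(γ − 1) + Σ_t [(q − 1)d_V(1 − 1/m_t) + Σ_α N_{t,α}·{(α + q − 1)/m_t}]` — the printed
«`d_ρ[(2q − 1)(g_S − 1) + deg Γ] + Σ_C r_C Σ_α N^ρ_{C,α}[(q − 1)(1 − 1/o(C)) + {(q − 1 − α)/o(C)}]`» at `Γ = 0` (the
source indexes the eigenvalues through the inverse generator, `α ↦ −α`). [cite: KopeliovichZemel2019, Theorem 6.6]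
[cite: ChevalleyWeil1934Integrale] [cite: FarkasKra1992, V.2.9 Theorem] -/
theorem chevalleyWeil_qDifferentials_sum_trace_inv_mul_trace_eq [Fintype ↥G] [DecidableEq ↥G] (hg : 2 ≤ arithGenus M)
    {q : ℕ} (hq : 2 ≤ q) (gen : M → ↥G)
    (hfix : ∀ P ∈ (ramificationDiv (mk G : M → OrbitSurface G M)).support, gen P • P = P)
    (hgen : ∀ P (hP : P ∈ (ramificationDiv (mk G : M → OrbitSurface G M)).support) (u : stabilizer G P),
      u ∈ Subgroup.zpowers (⟨gen P, mem_stabilizer_iff.2 (hfix P hP)⟩ : stabilizer G P)) :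
    ∑ h : ↥G, LinearMap.trace ℂ ↥(LC (q • ω₀.divisor))
        (LCRep ↥G (q • ω₀.divisor) (nsmul_divisor_smul_eq hω₀ hinv q) h⁻¹) * LinearMap.trace ℂ V (ρ h) =
      Nat.card ↥G * ((2 * (q : ℂ) - 1) * (finrank ℂ V : ℂ) * ((arithGenus (OrbitSurface G M) : ℂ) - 1)) +
      ∑ P ∈ (ramificationDiv (mk G : M → OrbitSurface G M)).support,
        (((q : ℂ) - 1) * (finrank ℂ V : ℂ) * ((Nat.card (stabilizer G P) : ℂ) - 1) +
          ∑ α ∈ Finset.range (Nat.card (stabilizer G P)),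
            (((α + q - 1) % Nat.card (stabilizer G P) : ℕ) : ℂ) *
              finrank ℂ ↥(Module.End.eigenspace (ρ (gen P)) (stabDeriv P (gen P) ^ α))) := by
  set R := (ramificationDiv (mk G : M → OrbitSurface G M)).support with hR
  have hq1 : 1 ≤ q := by omega
  -- split off `h = 1`
  rw [← Finset.add_sum_erase _ _ (Finset.mem_univ (1 : ↥G)), inv_one, trace_LCRep_subgroup_one G hω₀ hinv hg hq,
    trace_map_one_eq_finrank]
  -- Eichler at `h⁻¹` for `h ≠ 1`
  have hE : ∀ h ∈ (Finset.univ : Finset ↥G).erase 1,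
      LinearMap.trace ℂ ↥(LC (q • ω₀.divisor)) (LCRep ↥G (q • ω₀.divisor) (nsmul_divisor_smul_eq hω₀ hinv q) h⁻¹) *
          LinearMap.trace ℂ V (ρ h) =
        ∑ P ∈ R.filter (fun P ↦ h • P = P), stabDeriv P h ^ q / (1 - stabDeriv P h) * LinearMap.trace ℂ V (ρ h) := by
    intro h hh
    have hh1 : h ≠ 1 := Finset.ne_of_mem_erase hh
    rw [trace_LCRep_subgroup_inv_eq_sum_fixedBy G hω₀ hinv hg hq hh1, toFinset_fixedBy_eq_filter G hh1, Finset.sum_mul]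
  rw [Finset.sum_congr rfl hE,
    sum_erase_one_sum_filter_eq_sum_support_sum G (fun P h ↦ stabDeriv P h ^ q / (1 - stabDeriv P h) * LinearMap.trace ℂ V (ρ h))]
  -- the fixed-point contributions
  have hB : ∀ P ∈ R, ∑ h ∈ (Finset.univ.filter fun h : ↥G ↦ h • P = P).erase 1,
      stabDeriv P h ^ q / (1 - stabDeriv P h) * LinearMap.trace ℂ V (ρ h) =
      ∑ α ∈ Finset.range (Nat.card (stabilizer G P)),
          (((α + q - 1) % Nat.card (stabilizer G P) : ℕ) : ℂ) *
            finrank ℂ ↥(Module.End.eigenspace (ρ (gen P)) (stabDeriv P (gen P) ^ α)) -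
        (finrank ℂ V : ℂ) * (((Nat.card (stabilizer G P) : ℕ) : ℂ) - 1) / 2 :=
    fun P hP ↦ sum_stabilizer_stabDeriv_pow_div_mul_trace_eq G ρ hq1 (hfix P hP) (hgen P hP)
  rw [Finset.sum_congr rfl hB, Finset.sum_sub_distrib]
  -- Riemann–Hurwitz
  have hdeg : ∑ P ∈ R, (finrank ℂ V : ℂ) * (((Nat.card (stabilizer G P) : ℕ) : ℂ) - 1) / 2 =
      (finrank ℂ V : ℂ) / 2 * ((Finsupp.degree (ramificationDiv (mk G : M → OrbitSurface G M)) : ℤ) : ℂ) := by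
    rw [degree_ramificationDiv_mk_eq_sum_card_stabilizer_sub_one, Finset.mul_sum]
    refine Finset.sum_congr rfl fun P _ ↦ ?_
    ring
  have hdeg' : ∑ P ∈ R, (((q : ℂ) - 1) * (finrank ℂ V : ℂ) * ((Nat.card (stabilizer G P) : ℂ) - 1) +
      ∑ α ∈ Finset.range (Nat.card (stabilizer G P)),
        (((α + q - 1) % Nat.card (stabilizer G P) : ℕ) : ℂ) *
          finrank ℂ ↥(Module.End.eigenspace (ρ (gen P)) (stabDeriv P (gen P) ^ α))) =
      ((q : ℂ) - 1) * (finrank ℂ V : ℂ) * ((Finsupp.degree (ramificationDiv (mk G : M → OrbitSurface G M)) : ℤ) : ℂ) +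
      ∑ P ∈ R, ∑ α ∈ Finset.range (Nat.card (stabilizer G P)),
        (((α + q - 1) % Nat.card (stabilizer G P) : ℕ) : ℂ) *
          finrank ℂ ↥(Module.End.eigenspace (ρ (gen P)) (stabDeriv P (gen P) ^ α)) := by
    rw [Finset.sum_add_distrib, degree_ramificationDiv_mk_eq_sum_card_stabilizer_sub_one, Finset.mul_sum]
  have hRH := OrbitSurface.two_mul_arithGenus_sub_two_eq (H := ↥G) (M := M)
  have hRH' := congrArg (fun z : ℤ ↦ (z : ℂ)) hRH
  push_cast at hRH'
  rw [hdeg, hdeg']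
  linear_combination ((2 * (q : ℂ) - 1) * (finrank ℂ V : ℂ) / 2) * hRH'

open Classical in
/-- **THE CHEVALLEY–WEIL FORMULA FOR `q`-DIFFERENTIALS (intrinsic form)**, `N_{P,α} = dim ⋂_{h ∈ G_P} Eig(ρ(h), a_P(h)^α)`
the multiplicity of the character `a_P^α` of `G_P` in `V|_{G_P}` (no choice of generators).
[cite: KopeliovichZemel2019, Theorem 6.6] [cite: ChevalleyWeil1934Integrale] -/
theorem chevalleyWeil_qDifferentials_sum_trace_inv_mul_trace_eq_iInf [Fintype ↥G] [DecidableEq ↥G]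
    (hg : 2 ≤ arithGenus M) {q : ℕ} (hq : 2 ≤ q) :
    ∑ h : ↥G, LinearMap.trace ℂ ↥(LC (q • ω₀.divisor))
        (LCRep ↥G (q • ω₀.divisor) (nsmul_divisor_smul_eq hω₀ hinv q) h⁻¹) * LinearMap.trace ℂ V (ρ h) =
      Nat.card ↥G * ((2 * (q : ℂ) - 1) * (finrank ℂ V : ℂ) * ((arithGenus (OrbitSurface G M) : ℂ) - 1)) +
      ∑ P ∈ (ramificationDiv (mk G : M → OrbitSurface G M)).support,
        (((q : ℂ) - 1) * (finrank ℂ V : ℂ) * ((Nat.card (stabilizer G P) : ℂ) - 1) +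
          ∑ α ∈ Finset.range (Nat.card (stabilizer G P)),
            (((α + q - 1) % Nat.card (stabilizer G P) : ℕ) : ℂ) *
              finrank ℂ ↥(⨅ h : ↥(stabilizer G P),
                Module.End.eigenspace (ρ (h : ↥G)) (stabDeriv P (h : ↥G) ^ α))) := by
  obtain ⟨gen, hfix, hgen⟩ := exists_stabilizer_generators G
  rw [chevalleyWeil_qDifferentials_sum_trace_inv_mul_trace_eq G ρ hω₀ hinv hg hq gen (fun P _ ↦ hfix P)
    (fun P _ ↦ hgen P)]
  congr 1
  refine Finset.sum_congr rfl fun P _ ↦ ?_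
  congr 1
  refine Finset.sum_congr rfl fun α _ ↦ ?_
  rw [eigenspace_eq_iInf_eigenspace_stabDeriv_pow G ρ (hfix P) (hgen P) α]

omit hω₀ hinv

omit [CompactSpace M] [Nonempty M] [FiniteDimensional ℂ V] in
/-- `N_{g•P,α} = N_{P,α}` (the local multiplicities are constant along the fibres of `π`).
[cite: KopeliovichZemel2019, Theorem 6.6 (proof: «the values we consider depend only on `C`»)] -/
theorem finrank_iInf_eigenspace_smul (g : ↥G) (P : M) (α : ℕ) :
    finrank ℂ ↥(⨅ h : ↥(stabilizer G (g • P)), Module.End.eigenspace (ρ (h : ↥G)) (stabDeriv (g • P) (h : ↥G) ^ α)) =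
      finrank ℂ ↥(⨅ h : ↥(stabilizer G P), Module.End.eigenspace (ρ (h : ↥G)) (stabDeriv P (h : ↥G) ^ α)) := by
  obtain ⟨gen, hfix, hgen⟩ := exists_stabilizer_generators G
  have hfix' := conj_smul_smul G (hfix P) g
  have hgen' := forall_mem_zpowers_conj G (hfix P) (hgen P) g hfix'
  rw [← eigenspace_eq_iInf_eigenspace_stabDeriv_pow G ρ hfix' hgen' α,
    ← eigenspace_eq_iInf_eigenspace_stabDeriv_pow G ρ (hfix P) (hgen P) α,
    stabDeriv_conj hhol_of_holomorphicSMul g (hfix P), finrank_eigenspace_conj]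

include hω₀ hinv

open Classical in
/-- **THE CHEVALLEY–WEIL FORMULA FOR `q`-DIFFERENTIALS, grouped over the branch values** (`q ≥ 2`, `g ≥ 2`;
`r_t` the stabilizer order over the branch value `q_t`, `#π⁻¹(q_t) = |G|/r_t`, `N_{t,α}` at `P_t = q_t.out`):
`|G|⁻¹·Σ_{h ∈ G} tr(h⁻¹|𝓗^q(M))·χ_V(h) = (2q − 1)·dim V·(γ − 1) + Σ_t [(q − 1)·dim V·(1 − 1/r_t) + Σ_α N_{t,α}·((α + q − 1) mod r_t)/r_t]`
— for irreducible `V` the multiplicity of `V` in `𝓗^q(M)`, «`d_ρ(2q − 1)(g_S − 1) + Σ_C r_C Σ_α N^ρ_{C,α}[(q − 1)(1 − 1/o(C)) + {(q − 1 − α)/o(C)}]`»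
(`Γ = 0`; the source's `α` is our `−α`). [cite: KopeliovichZemel2019, Theorem 6.6] [cite: ChevalleyWeil1934Integrale] -/
theorem chevalleyWeil_qDifferentials_multiplicity_eq_sum_branchValues [Fintype ↥G] [DecidableEq ↥G]
    (hg : 2 ≤ arithGenus M) {q : ℕ} (hq : 2 ≤ q) :
    (Nat.card ↥G : ℂ)⁻¹ * ∑ h : ↥G, LinearMap.trace ℂ ↥(LC (q • ω₀.divisor))
        (LCRep ↥G (q • ω₀.divisor) (nsmul_divisor_smul_eq hω₀ hinv q) h⁻¹) * LinearMap.trace ℂ V (ρ h) =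
      (2 * (q : ℂ) - 1) * (finrank ℂ V : ℂ) * ((arithGenus (OrbitSurface G M) : ℂ) - 1) +
      ∑ x ∈ (branchDiv (mk G : M → OrbitSurface G M)).support,
        (((q : ℂ) - 1) * (finrank ℂ V : ℂ) * (1 - (stabOrder x : ℂ)⁻¹) +
          ∑ α ∈ Finset.range (stabOrder x),
            (((α + q - 1) % stabOrder x : ℕ) : ℂ) / (stabOrder x : ℂ) *
              finrank ℂ ↥(⨅ h : ↥(stabilizer G x.out),
                Module.End.eigenspace (ρ (h : ↥G)) (stabDeriv x.out (h : ↥G) ^ α))) := by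
  have hG : (Nat.card ↥G : ℂ) ≠ 0 := Nat.cast_ne_zero.2 Nat.card_pos.ne'
  rw [chevalleyWeil_qDifferentials_sum_trace_inv_mul_trace_eq_iInf G ρ hω₀ hinv hg hq,
    sum_support_ramificationDiv_eq_sum_support_branchDiv G _ (fun g P ↦ by
      simp_rw [card_stabilizer_smul, finrank_iInf_eigenspace_smul G ρ g P]),
    mul_add, ← mul_assoc, inv_mul_cancel₀ hG, one_mul, Finset.mul_sum]
  congr 1
  refine Finset.sum_congr rfl fun x _ ↦ ?_
  have hr : (stabOrder x : ℂ) ≠ 0 := Nat.cast_ne_zero.2 (Nat.one_le_iff_ne_zero.1 (one_le_stabOrder x))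
  have hcard : (((mk G : M → OrbitSurface G M) ⁻¹' {x}).ncard : ℂ) = Nat.card ↥G / (stabOrder x : ℂ) := by
    rw [eq_div_iff hr, ← Nat.cast_mul, ncard_preimage_mk_mul_stabOrder]
  -- `stabOrder x = Nat.card (stabilizer G x.out)` by definition
  change (Nat.card ↥G : ℂ)⁻¹ * ((((mk G : M → OrbitSurface G M) ⁻¹' {x}).ncard : ℂ) *
      (((q : ℂ) - 1) * (finrank ℂ V : ℂ) * ((stabOrder x : ℂ) - 1) +
        ∑ α ∈ Finset.range (stabOrder x), (((α + q - 1) % stabOrder x : ℕ) : ℂ) *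
          (finrank ℂ ↥(⨅ h : ↥(stabilizer G x.out),
            Module.End.eigenspace (ρ (h : ↥G)) (stabDeriv x.out (h : ↥G) ^ α)) : ℂ))) = _
  rw [hcard, mul_add, mul_add, Finset.mul_sum, Finset.mul_sum]
  congr 1
  · field_simp
  · refine Finset.sum_congr rfl fun α _ ↦ ?_
    field_simp

end Global

end RiemannSurface

end Literature.Geometry.Kaehler

end
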